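import Summits.KontsevichZagierPeriods.KontsevichZagierPeriods.Theorems.SoloInformedTelescopeKit
import HarnessLib
import HarnessLib.Audit

/-!
# SoloInformed — domains, integrands and the substitution `Φ` of the weight-3 Möbius telescope

Solo programme `solo-KontsevichZagierPeriods-informed`, session s45 (PART XVI, the mixed Tate
sector). Coordinates on `ℝ³`: `y = x₀` (passive), `u = x₁`, `w = x₂`; `O = (0,1)³`.
Domains `D₁ = O ∩ {w < u}`, `D₂ = O ∩ {u < w}`, `D♯ = O ∩ {w² < u < w}`; integrands
`f₁ = 1/((1−yu)(1−w))`, `S = 1/((1−yu)(1−yuw))`, `g = w/((1−yuw)(1−w))`,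
`f_V = w/((1−yuw)(1−yuw²))` with their dominations by weights `∏ (1 − xᵢ)^{−eᵢ}` (`eᵢ < 1`);
the monomial substitution `Φ(y,u,w) = (y,uw,w)` with `det J_Φ = w`, `Φ(D₁) = D♯`, `Φ(O) = D₂`.
The representations are assembled in `SoloInformedTelescopeReps`.

References: M. Kontsevich, D. Zagier, *Periods* (2001), §1.2 [KontsevichZagier2001].
-/

noncomputable section

open MeasureTheory Set MvPolynomial
open Literature.ModelTheory.ExponentialFields Literature.NumberTheory.Transcendental
open Literature.NumberTheory.Transcendental.KZ

namespace Summit.KontsevichZagierPeriods.KontsevichZagierPeriods.Theorems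

/-! ## 1. Domains -/

/-- `D₁ = (0,1)³ ∩ {w < u}`. -/
def soloInformedTelD1 : Set (Fin 3 → ℝ) := soloInformedOpenCube 3 ∩ {x | x 2 < x 1}

/-- `D₂ = (0,1)³ ∩ {u < w}`. -/
def soloInformedTelD2 : Set (Fin 3 → ℝ) := soloInformedOpenCube 3 ∩ {x | x 1 < x 2}

/-- `D♯ = (0,1)³ ∩ {w² < u < w}`. -/
def soloInformedTelDs : Set (Fin 3 → ℝ) :=
  soloInformedOpenCube 3 ∩ ({x | x 2 ^ 2 < x 1} ∩ {x | x 1 < x 2})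

/-- Auxiliary (weight-3 telescope): `soloInformedTelD1_subset`. -/
theorem soloInformedTelD1_subset : soloInformedTelD1 ⊆ soloInformedOpenCube 3 := inter_subset_left
/-- Auxiliary (weight-3 telescope): `soloInformedTelD2_subset`. -/
theorem soloInformedTelD2_subset : soloInformedTelD2 ⊆ soloInformedOpenCube 3 := inter_subset_left
/-- Auxiliary (weight-3 telescope): `soloInformedTelDs_subset`. -/
theorem soloInformedTelDs_subset : soloInformedTelDs ⊆ soloInformedOpenCube 3 := inter_subset_left

/-- A strict polynomial inequality cuts out a `ℚ`-semialgebraic set (three variables). -/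
theorem soloInformed_isSemialgebraic_lt3 (p q : MvPolynomial (Fin 3) ℚ) :
    IsSemialgebraic ℚ {x : Fin 3 → ℝ | (aeval x p : ℝ) < aeval x q} :=
  isSemialgebraic_setOf_eval_lt (k := ℚ) (R := ℝ) p q

/-- `{x | p(x) < q(x)}` for the coordinate polynomials used below. -/
theorem soloInformed_isSemialgebraic_lt3' (p q : MvPolynomial (Fin 3) ℚ) (P Q : (Fin 3 → ℝ) → ℝ)
    (hP : ∀ x, (aeval x p : ℝ) = P x) (hQ : ∀ x, (aeval x q : ℝ) = Q x) :
    IsSemialgebraic ℚ {x : Fin 3 → ℝ | P x < Q x} := by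
  have h := soloInformed_isSemialgebraic_lt3 p q
  simp only [hP, hQ] at h
  exact h

/-- Auxiliary (weight-3 telescope): `isSemialgebraic_soloInformedTelD1`. -/
theorem isSemialgebraic_soloInformedTelD1 : IsSemialgebraic ℚ soloInformedTelD1 :=
  (isSemialgebraic_soloInformedOpenCube 3).inter
    (soloInformed_isSemialgebraic_lt3' (X 2) (X 1) (fun x => x 2) (fun x => x 1) (fun x => by simp)
      fun x => by simp)

/-- Auxiliary (weight-3 telescope): `isSemialgebraic_soloInformedTelD2`. -/
theorem isSemialgebraic_soloInformedTelD2 : IsSemialgebraic ℚ soloInformedTelD2 :=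
  (isSemialgebraic_soloInformedOpenCube 3).inter
    (soloInformed_isSemialgebraic_lt3' (X 1) (X 2) (fun x => x 1) (fun x => x 2) (fun x => by simp)
      fun x => by simp)

/-- Auxiliary (weight-3 telescope): `isSemialgebraic_soloInformedTelDs`. -/
theorem isSemialgebraic_soloInformedTelDs : IsSemialgebraic ℚ soloInformedTelDs :=
  (isSemialgebraic_soloInformedOpenCube 3).inter
    ((soloInformed_isSemialgebraic_lt3' (X 2 ^ 2) (X 1) (fun x => x 2 ^ 2) (fun x => x 1)
      (fun x => by simp) fun x => by simp).inter
    (soloInformed_isSemialgebraic_lt3' (X 1) (X 2) (fun x => x 1) (fun x => x 2) (fun x => by simp)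
      fun x => by simp))

/-- Auxiliary (weight-3 telescope): `soloInformed_measurableSet_telD1`. -/
theorem soloInformed_measurableSet_telD1 : MeasurableSet soloInformedTelD1 :=
  soloInformed_measurableSet_openCube3.inter
    (measurableSet_lt (measurable_pi_apply 2) (measurable_pi_apply 1))

/-- Auxiliary (weight-3 telescope): `soloInformed_measurableSet_telD2`. -/
theorem soloInformed_measurableSet_telD2 : MeasurableSet soloInformedTelD2 :=
  soloInformed_measurableSet_openCube3.inter
    (measurableSet_lt (measurable_pi_apply 1) (measurable_pi_apply 2))

/-! ## 2. Elementary bounds on the open cube -/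

section bounds
variable {x : Fin 3 → ℝ}

/-- Auxiliary (weight-3 telescope): `soloInformed_oc3`. -/
theorem soloInformed_oc3 (hx : x ∈ soloInformedOpenCube 3) (i : Fin 3) : 0 < x i ∧ x i < 1 := hx i

/-- `1 − yu > 0` on the cube. -/
theorem soloInformed_one_sub_yu_pos (hx : x ∈ soloInformedOpenCube 3) : 0 < 1 - x 0 * x 1 := by
  have h0 := hx 0; have h1 := hx 1; nlinarith

/-- `1 − yuw > 0` on the cube. -/
theorem soloInformed_one_sub_yuw_pos (hx : x ∈ soloInformedOpenCube 3) :
    0 < 1 - x 0 * x 1 * x 2 := by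
  have h0 := hx 0; have h1 := hx 1; have h2 := hx 2
  have : x 0 * x 1 < 1 := by nlinarith
  nlinarith [mul_pos h0.1 h1.1]

/-- `1 − yuw² > 0` on the cube. -/
theorem soloInformed_one_sub_yuww_pos (hx : x ∈ soloInformedOpenCube 3) :
    0 < 1 - x 0 * x 1 * x 2 * x 2 := by
  have h2 := hx 2
  have h := soloInformed_one_sub_yuw_pos hx
  nlinarith [mul_pos (mul_pos (hx 0).1 (hx 1).1) h2.1]

/-- `1 − w > 0` on the cube. -/
theorem soloInformed_one_sub_w_pos (hx : x ∈ soloInformedOpenCube 3) : 0 < 1 - x 2 := by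
  linarith [(hx 2).2]

end bounds

/-! ## 3. Integrands and their dominations -/

/-- `f₁ = 1/((1−yu)(1−w))`. -/
def soloInformedTelF1 (x : Fin 3 → ℝ) : ℝ := 1 / ((1 - x 0 * x 1) * (1 - x 2))
/-- `S = 1/((1−yu)(1−yuw))`. -/
def soloInformedTelS (x : Fin 3 → ℝ) : ℝ := 1 / ((1 - x 0 * x 1) * (1 - x 0 * x 1 * x 2))
/-- `g = w/((1−yuw)(1−w))`. -/
def soloInformedTelG (x : Fin 3 → ℝ) : ℝ := x 2 / ((1 - x 0 * x 1 * x 2) * (1 - x 2))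
/-- `f_V = w/((1−yuw)(1−yuw²))`. -/
def soloInformedTelFV (x : Fin 3 → ℝ) : ℝ :=
  x 2 / ((1 - x 0 * x 1 * x 2) * (1 - x 0 * x 1 * x 2 * x 2))

/-- Auxiliary (weight-3 telescope): `soloInformedTelF1_pos`. -/
theorem soloInformedTelF1_pos {x : Fin 3 → ℝ} (hx : x ∈ soloInformedOpenCube 3) :
    0 < soloInformedTelF1 x :=
  one_div_pos.2 (mul_pos (soloInformed_one_sub_yu_pos hx) (soloInformed_one_sub_w_pos hx))

/-- Auxiliary (weight-3 telescope): `soloInformedTelS_pos`. -/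
theorem soloInformedTelS_pos {x : Fin 3 → ℝ} (hx : x ∈ soloInformedOpenCube 3) :
    0 < soloInformedTelS x :=
  one_div_pos.2 (mul_pos (soloInformed_one_sub_yu_pos hx) (soloInformed_one_sub_yuw_pos hx))

/-- Auxiliary (weight-3 telescope): `soloInformedTelG_pos`. -/
theorem soloInformedTelG_pos {x : Fin 3 → ℝ} (hx : x ∈ soloInformedOpenCube 3) :
    0 < soloInformedTelG x :=
  div_pos (hx 2).1 (mul_pos (soloInformed_one_sub_yuw_pos hx) (soloInformed_one_sub_w_pos hx))

/-- Continuity of the integrands on the open cube. -/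
theorem soloInformed_continuousOn_telF1 : ContinuousOn soloInformedTelF1 (soloInformedOpenCube 3) := by
  refine ContinuousOn.div continuousOn_const (by fun_prop) fun x hx => ?_
  exact (mul_pos (soloInformed_one_sub_yu_pos hx) (soloInformed_one_sub_w_pos hx)).ne'

/-- Auxiliary (weight-3 telescope): `soloInformed_continuousOn_telS`. -/
theorem soloInformed_continuousOn_telS : ContinuousOn soloInformedTelS (soloInformedOpenCube 3) := by
  refine ContinuousOn.div continuousOn_const (by fun_prop) fun x hx => ?_
  exact (mul_pos (soloInformed_one_sub_yu_pos hx) (soloInformed_one_sub_yuw_pos hx)).ne'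

/-- Auxiliary (weight-3 telescope): `soloInformed_continuousOn_telG`. -/
theorem soloInformed_continuousOn_telG : ContinuousOn soloInformedTelG (soloInformedOpenCube 3) := by
  refine ContinuousOn.div (by fun_prop) (by fun_prop) fun x hx => ?_
  exact (mul_pos (soloInformed_one_sub_yuw_pos hx) (soloInformed_one_sub_w_pos hx)).ne'

/-- The exponent vectors of the dominating weights. -/
def soloInformedTelE1 : Fin 3 → ℝ := ![1 / 2, 3 / 4, 3 / 4]
/-- Auxiliary (weight-3 telescope): `soloInformedTelE2`. -/
def soloInformedTelE2 : Fin 3 → ℝ := ![3 / 4, 1 / 2, 3 / 4]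

/-- Auxiliary (weight-3 telescope): `soloInformedTelE1_zero`. -/
@[simp] theorem soloInformedTelE1_zero : soloInformedTelE1 0 = 1 / 2 := rfl
/-- Auxiliary (weight-3 telescope): `soloInformedTelE1_one`. -/
@[simp] theorem soloInformedTelE1_one : soloInformedTelE1 1 = 3 / 4 := rfl
/-- Auxiliary (weight-3 telescope): `soloInformedTelE1_two`. -/
@[simp] theorem soloInformedTelE1_two : soloInformedTelE1 2 = 3 / 4 := rfl
/-- Auxiliary (weight-3 telescope): `soloInformedTelE2_zero`. -/
@[simp] theorem soloInformedTelE2_zero : soloInformedTelE2 0 = 3 / 4 := rfl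
/-- Auxiliary (weight-3 telescope): `soloInformedTelE2_one`. -/
@[simp] theorem soloInformedTelE2_one : soloInformedTelE2 1 = 1 / 2 := rfl
/-- Auxiliary (weight-3 telescope): `soloInformedTelE2_two`. -/
@[simp] theorem soloInformedTelE2_two : soloInformedTelE2 2 = 3 / 4 := rfl

/-- Auxiliary (weight-3 telescope): `soloInformedTelE1_lt_one`. -/
theorem soloInformedTelE1_lt_one (i : Fin 3) : soloInformedTelE1 i < 1 := by
  fin_cases i <;> simp <;> norm_num
/-- Auxiliary (weight-3 telescope): `soloInformedTelE2_lt_one`. -/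
theorem soloInformedTelE2_lt_one (i : Fin 3) : soloInformedTelE2 i < 1 := by
  fin_cases i <;> simp <;> norm_num

/-- **Domination of `f₁` on `D₁`**: `f₁ ≤ (1−y)^{−1/2} (1−u)^{−3/4} (1−w)^{−3/4}` (uses `w < u`). -/
theorem soloInformedTelF1_le_W3 {x : Fin 3 → ℝ} (hx : x ∈ soloInformedTelD1) :
    soloInformedTelF1 x ≤ soloInformedW3 soloInformedTelE1 x := by
  have h0 := hx.1 0; have h1 := hx.1 1; have h2 := hx.1 2
  have hwu : x 2 < x 1 := hx.2
  have hp1 := soloInformed_one_div_one_sub_mul_le (α := 1 / 2) (β := 1 / 2) h0.1.le h0.2 h1.1.le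
    h1.2 (by norm_num) (by norm_num) (by norm_num)
  have hsplit : 1 / (1 - x 2) = (1 - x 2) ^ (-(3 / 4 : ℝ)) * (1 - x 2) ^ (-(1 / 4 : ℝ)) := by
    rw [soloInformed_one_div_eq_rpow_neg_one h2.2, ← soloInformed_rpow_neg_add h2.2]; norm_num
  have hmono : (1 - x 2) ^ (-(1 / 4 : ℝ)) ≤ (1 - x 1) ^ (-(1 / 4 : ℝ)) :=
    soloInformed_rpow_neg_antitone h1.2 hwu.le (by norm_num)
  have hc : 0 ≤ (1 - x 2) ^ (-(3 / 4 : ℝ)) := Real.rpow_nonneg (by linarith) _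
  have hu14 : (1 - x 1) ^ (-(3 / 4 : ℝ)) = (1 - x 1) ^ (-(1 / 2 : ℝ)) * (1 - x 1) ^ (-(1 / 4 : ℝ)) := by
    rw [← soloInformed_rpow_neg_add h1.2]; norm_num
  calc soloInformedTelF1 x = 1 / (1 - x 0 * x 1) * (1 / (1 - x 2)) := by
        rw [soloInformedTelF1, one_div_mul_one_div]
    _ ≤ (1 - x 0) ^ (-(1 / 2 : ℝ)) * (1 - x 1) ^ (-(1 / 2 : ℝ)) *
        ((1 - x 2) ^ (-(3 / 4 : ℝ)) * (1 - x 1) ^ (-(1 / 4 : ℝ))) := by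
        refine mul_le_mul hp1 ?_ (one_div_pos.2 (by linarith)).le
          (mul_nonneg (Real.rpow_nonneg (by linarith) _) (Real.rpow_nonneg (by linarith) _))
        rw [hsplit]
        exact mul_le_mul_of_nonneg_left hmono hc
    _ = soloInformedW3 soloInformedTelE1 x := by
        rw [soloInformedW3_eq, soloInformedTelE1_zero, soloInformedTelE1_one, soloInformedTelE1_two,
          hu14]; ring

/-- **Domination of `S` on the cube**: `S ≤ (1−y)^{−3/4} (1−u)^{−1/2} (1−w)^{−3/4}`. -/
theorem soloInformedTelS_le_W3 {x : Fin 3 → ℝ} (hx : x ∈ soloInformedOpenCube 3) :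
    soloInformedTelS x ≤ soloInformedW3 soloInformedTelE2 x := by
  have h0 := hx 0; have h1 := hx 1; have h2 := hx 2
  have hp1 := soloInformed_one_div_one_sub_mul_le (α := 1 / 2) (β := 1 / 2) h0.1.le h0.2 h1.1.le
    h1.2 (by norm_num) (by norm_num) (by norm_num)
  have hp2 := soloInformed_one_div_one_sub_mul_le (α := 1 / 4) (β := 3 / 4) h0.1.le h0.2 h2.1.le
    h2.2 (by norm_num) (by norm_num) (by norm_num)
  have hyw : 1 / (1 - x 0 * x 1 * x 2) ≤ 1 / (1 - x 0 * x 2) := by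
    refine one_div_le_one_div_of_le (by nlinarith) ?_
    nlinarith [mul_nonneg h0.1.le h2.1.le]
  have hy34 : (1 - x 0) ^ (-(3 / 4 : ℝ)) = (1 - x 0) ^ (-(1 / 2 : ℝ)) * (1 - x 0) ^ (-(1 / 4 : ℝ)) := by
    rw [← soloInformed_rpow_neg_add h0.2]; norm_num
  calc soloInformedTelS x = 1 / (1 - x 0 * x 1) * (1 / (1 - x 0 * x 1 * x 2)) := by
        rw [soloInformedTelS, one_div_mul_one_div]
    _ ≤ (1 - x 0) ^ (-(1 / 2 : ℝ)) * (1 - x 1) ^ (-(1 / 2 : ℝ)) *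
        ((1 - x 0) ^ (-(1 / 4 : ℝ)) * (1 - x 2) ^ (-(3 / 4 : ℝ))) :=
        mul_le_mul hp1 (hyw.trans hp2) (one_div_pos.2 (soloInformed_one_sub_yuw_pos hx)).le
          (mul_nonneg (Real.rpow_nonneg (by linarith) _) (Real.rpow_nonneg (by linarith) _))
    _ = soloInformedW3 soloInformedTelE2 x := by
        rw [soloInformedW3_eq, soloInformedTelE2_zero, soloInformedTelE2_one, soloInformedTelE2_two,
          hy34]; ring

/-- `g ≤ f₁` on the cube (`w ≤ 1`, `yuw ≤ yu`). -/
theorem soloInformedTelG_le_F1 {x : Fin 3 → ℝ} (hx : x ∈ soloInformedOpenCube 3) :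
    soloInformedTelG x ≤ soloInformedTelF1 x := by
  have h0 := hx 0; have h1 := hx 1; have h2 := hx 2
  have ha := soloInformed_one_sub_yu_pos hx
  have hb := soloInformed_one_sub_yuw_pos hx
  have hc := soloInformed_one_sub_w_pos hx
  rw [soloInformedTelG, soloInformedTelF1, div_le_div_iff₀ (mul_pos hb hc) (mul_pos ha hc)]
  nlinarith [mul_pos ha hc, mul_pos hb hc, mul_nonneg (mul_nonneg h0.1.le h1.1.le) h2.1.le,
    mul_pos hc hc]

/-! ## 4. The substitution `Φ(y,u,w) = (y, uw, w)` -/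

/-- The components of `Φ`. -/
def soloInformedTelPhiPoly : Fin 3 → MvPolynomial (Fin 3) ℚ := ![X 0, X 1 * X 2, X 2]

/-- `Φ(y,u,w) = (y, uw, w)`. -/
def soloInformedTelPhi : (Fin 3 → ℝ) → (Fin 3 → ℝ) := soloInformedPolyMap soloInformedTelPhiPoly

/-- Auxiliary (weight-3 telescope): `soloInformedTelPhi_zero`. -/
@[simp] theorem soloInformedTelPhi_zero (x : Fin 3 → ℝ) : soloInformedTelPhi x 0 = x 0 := by
  simp [soloInformedTelPhi, soloInformedTelPhiPoly]
/-- Auxiliary (weight-3 telescope): `soloInformedTelPhi_one`. -/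
@[simp] theorem soloInformedTelPhi_one (x : Fin 3 → ℝ) : soloInformedTelPhi x 1 = x 1 * x 2 := by
  simp [soloInformedTelPhi, soloInformedTelPhiPoly]
/-- Auxiliary (weight-3 telescope): `soloInformedTelPhi_two`. -/
@[simp] theorem soloInformedTelPhi_two (x : Fin 3 → ℝ) : soloInformedTelPhi x 2 = x 2 := by
  simp [soloInformedTelPhi, soloInformedTelPhiPoly]

/-- **Jacobian of `Φ`**: `det J_Φ = w`. -/
theorem soloInformed_det_telPhi (x : Fin 3 → ℝ) :
    (soloInformedJacCLM soloInformedTelPhiPoly x).det = x 2 := by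
  rw [soloInformed_det_jacCLM, Matrix.det_fin_three]
  simp [soloInformedTelPhiPoly, soloInformedJacMat_apply, pderiv_X]

/-- `Φ` is injective on the open cube. -/
theorem soloInformed_injOn_telPhi : InjOn soloInformedTelPhi (soloInformedOpenCube 3) := by
  intro x hx x' hx' h
  have h0 := congr_fun h 0; have h1 := congr_fun h 1; have h2 := congr_fun h 2
  simp only [soloInformedTelPhi_zero, soloInformedTelPhi_one, soloInformedTelPhi_two] at h0 h1 h2
  have hw : x 2 ≠ 0 := (hx 2).1.ne'
  have hu : x 1 = x' 1 := by
    rw [← h2] at h1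
    exact mul_right_cancel₀ hw h1
  ext j; fin_cases j
  · exact h0
  · exact hu
  · exact h2

/-- **`Φ(D₁) = D♯`.** -/
theorem soloInformed_image_telPhi_D1 : soloInformedTelPhi '' soloInformedTelD1 = soloInformedTelDs := by
  refine Subset.antisymm ?_ fun x hx => ?_
  · rintro _ ⟨x, hx, rfl⟩
    have h0 := hx.1 0; have h1 := hx.1 1; have h2 := hx.1 2
    have hwu : x 2 < x 1 := hx.2
    refine ⟨fun j => ?_, ?_, ?_⟩
    · fin_cases j
      · simpa using h0
      · show 0 < soloInformedTelPhi x 1 ∧ soloInformedTelPhi x 1 < 1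
        rw [soloInformedTelPhi_one]
        exact ⟨mul_pos h1.1 h2.1, by nlinarith⟩
      · simpa using h2
    · show soloInformedTelPhi x 2 ^ 2 < soloInformedTelPhi x 1
      simp only [soloInformedTelPhi_one, soloInformedTelPhi_two]; nlinarith
    · show soloInformedTelPhi x 1 < soloInformedTelPhi x 2
      simp only [soloInformedTelPhi_one, soloInformedTelPhi_two]; nlinarith
  · have h0 := hx.1 0; have h1 := hx.1 1; have h2 := hx.1 2
    have hsq : x 2 ^ 2 < x 1 := hx.2.1
    have huw : x 1 < x 2 := hx.2.2
    have hw : x 2 ≠ 0 := h2.1.ne'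
    refine ⟨![x 0, x 1 / x 2, x 2], ⟨fun j => ?_, ?_⟩, ?_⟩
    · fin_cases j
      · simpa using h0
      · simp only [Fin.mk_one, Matrix.cons_val_one, Matrix.cons_val_zero]
        exact ⟨div_pos h1.1 h2.1, (div_lt_one h2.1).2 huw⟩
      · simpa using h2
    · show (![x 0, x 1 / x 2, x 2] : Fin 3 → ℝ) 2 < (![x 0, x 1 / x 2, x 2] : Fin 3 → ℝ) 1
      simp only [Matrix.cons_val_one, Matrix.cons_val_zero, Matrix.cons_val_two, Matrix.tail_cons,
        Matrix.head_cons]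
      rw [lt_div_iff₀ h2.1, ← sq]; exact hsq
    · ext j; fin_cases j
      · simp
      · simp [div_mul_cancel₀ _ hw]
      · simp

/-- **`Φ((0,1)³) = D₂`.** -/
theorem soloInformed_image_telPhi_cube :
    soloInformedTelPhi '' soloInformedOpenCube 3 = soloInformedTelD2 := by
  refine Subset.antisymm ?_ fun x hx => ?_
  · rintro _ ⟨x, hx, rfl⟩
    have h0 := hx 0; have h1 := hx 1; have h2 := hx 2
    refine ⟨fun j => ?_, ?_⟩
    · fin_cases j
      · simpa using h0
      · show 0 < soloInformedTelPhi x 1 ∧ soloInformedTelPhi x 1 < 1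
        rw [soloInformedTelPhi_one]
        exact ⟨mul_pos h1.1 h2.1, by nlinarith⟩
      · simpa using h2
    · show soloInformedTelPhi x 1 < soloInformedTelPhi x 2
      simp only [soloInformedTelPhi_one, soloInformedTelPhi_two]; nlinarith
  · have h0 := hx.1 0; have h1 := hx.1 1; have h2 := hx.1 2
    have huw : x 1 < x 2 := hx.2
    have hw : x 2 ≠ 0 := h2.1.ne'
    refine ⟨![x 0, x 1 / x 2, x 2], fun j => ?_, ?_⟩
    · fin_cases j
      · simpa using h0
      · simp only [Fin.mk_one, Matrix.cons_val_one, Matrix.cons_val_zero]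
        exact ⟨div_pos h1.1 h2.1, (div_lt_one h2.1).2 huw⟩
      · simpa using h2
    · ext j; fin_cases j
      · simp
      · simp [div_mul_cancel₀ _ hw]
      · simp

end Summit.KontsevichZagierPeriods.KontsevichZagierPeriods.Theorems
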